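import Summits.Ventures.DiscreteObjects.PP12.OrderElevenHomologyScanSound
import Summits.Ventures.DiscreteObjects.PP12.OrderElevenHomologyScale

/-!
# PP(12), order-11 cell, Case A: the ORBIT MAP in the kernel and its bridge to `mulAct` (designs g22)
Framing: lottery ticket; floor = certified bounds/negative ranges.

Cell pub-namedobj (venture DiscreteObjects), target (M), P11-SIZING.md. `actP u u⁻¹ r` is the multiplier action on a PACKED row of index `1`
(digit `j ↦ u · r_(π_u⁻¹ j) mod 11`, hole digit `1`); `umapOK` checks with the literal orbit map `UMAP` that every row of `CANDS2` is carried onto its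
representative in `REPS` (`umapOK_true`, one `decide +kernel`; `exists_rep_of_umapOK`); and **`packRow_mulAct_one`**: for a normal array `a`, the packed
row `1` of `mulAct u a` (OrderElevenHomologyScale) IS `actP u u⁻¹ (packRow a 1)`. No `sorry`, no new axioms; nothing here asserts a census statement.
-/

set_option maxRecDepth 100000

namespace Summit.Ventures.DiscreteObjects.PP12

namespace Homology12

/-- inverse index relabelling of a multiplier: `π_u⁻¹ 0 = 0`, `π_u⁻¹ j = u⁻¹ (j − 1) mod 11 + 1` -/
def pinv (uinv j : ℕ) : ℕ := if j = 0 then 0 else (uinv * (j - 1)) % 11 + 1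

/-- **the packed multiplier action** on a row of index `1` -/
def actP (u uinv r : ℕ) : ℕ := pack16 (fun j => if j = 1 then 0 else (u * dg r (pinv uinv j)) % 11) 12

/-- inverses mod `11` of `1 … 10` (entry `u`) -/
def INV11 : List ℕ := [0, 1, 6, 4, 3, 9, 2, 8, 7, 5, 10]

/-- kernel check of the orbit map: multiplier in `1 … 10`, and the action carries the row onto the listed representative -/
def umapOK : Bool :=
  (List.zip CANDS2 UMAP).all fun p => (Nat.ble 1 p.2.1 && Nat.ble p.2.1 10) && (actP p.2.1 (INV11.getD p.2.1 0) p.1 == REPS.getD p.2.2 0)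

set_option maxHeartbeats 400000000 in
/-- the orbit-map check passes (kernel) -/
theorem umapOK_true : umapOK = true := by decide +kernel

/-- reading the orbit-map check at a listed row -/
theorem exists_rep_of_umapOK {r : ℕ} (hr : r ∈ CANDS2) :
    ∃ u k, 1 ≤ u ∧ u ≤ 10 ∧ actP u (INV11.getD u 0) r = REPS.getD k 0 ∧ k < REPS.length := by
  have h := umapOK_true
  have hlen : CANDS2.length = UMAP.length := by decide
  obtain ⟨n, hn, rfl⟩ := List.getElem_of_mem hr
  unfold umapOK at h
  rw [List.all_eq_true] at h
  have hmem : (CANDS2[n], UMAP[n]'(hlen ▸ hn)) ∈ List.zip CANDS2 UMAP := by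
    rw [List.mem_iff_getElem]
    exact ⟨n, by rw [List.length_zip, ← hlen, min_self]; exact hn, by rw [List.getElem_zip]⟩
  have := h _ hmem
  simp only [Bool.and_eq_true, Nat.ble_eq, beq_iff_eq] at this
  obtain ⟨⟨h1, h2⟩, h3⟩ := this
  refine ⟨(UMAP[n]'(hlen ▸ hn)).1, (UMAP[n]'(hlen ▸ hn)).2, h1, h2, h3, ?_⟩
  have hall : UMAP.all (fun p => Nat.blt p.2 REPS.length) = true := by decide
  rw [List.all_eq_true] at hall
  have := hall _ (List.getElem_mem (l := UMAP) (hlen ▸ hn))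
  simpa using this

/-! ### the bridge -/

/-- `pinv` stays below `12` -/
theorem pinv_lt (uinv j : ℕ) : pinv uinv j < 12 := by
  unfold pinv; split_ifs <;> omega

/-- the multiplier permutation inverts `pinv`: `mulMap u (π_u⁻¹ k) = k` (finite check over the ten units and the twelve indices) -/
theorem mulMap_pinv (u : ℕ) (hu1 : 1 ≤ u) (hu2 : u ≤ 10) (k : Fin 12) :
    mulMap (u : ZMod 11) ⟨pinv (INV11.getD u 0) k, pinv_lt _ _⟩ = k := by
  interval_cases u <;> revert k <;> decide

/-- `π_u⁻¹ k ≠ 1` for `k ≠ 1` (finite check) -/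
theorem pinv_ne_one (u : ℕ) (hu1 : 1 ≤ u) (hu2 : u ≤ 10) (k : Fin 12) (hk : k ≠ 1) : pinv (INV11.getD u 0) k ≠ 1 := by
  interval_cases u <;> revert k <;> decide

/-- `pack16` depends only on the digits below `n` -/
theorem pack16_congr {F G : ℕ → ℕ} {n : ℕ} (h : ∀ i < n, F i = G i) : pack16 F n = pack16 G n := by
  induction n with
  | zero => rfl
  | succ n ih => rw [pack16, pack16, ih fun i hi => h i (by omega), h n (by omega)]

/-- **the bridge**: the packed row `1` of `mulAct u a` is the packed action on the packed row `1` of `a` -/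
theorem packRow_mulAct_one (a : Fin 12 → Fin 12 → ZMod 11) {u : ℕ} (hu1 : 1 ≤ u) (hu2 : u ≤ 10) (hu0 : ((u : ℕ) : ZMod 11) ≠ 0) :
    packRow (mulAct hu0 a) 1 = actP u (INV11.getD u 0) (packRow a 1) := by
  unfold packRow actP
  apply pack16_congr
  intro k hk
  set kk : Fin 12 := ⟨k, hk⟩ with hkk
  have hsymm : ∀ j : Fin 12, (mulPerm hu0).symm j = ⟨pinv (INV11.getD u 0) j, pinv_lt _ _⟩ := fun j => by
    rw [Equiv.symm_apply_eq, mulPerm_apply]; exact (mulMap_pinv u hu1 hu2 j).symm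
  by_cases hk1 : k = 1
  · subst hk1; simp [rowDigit]
  · have hkk1 : kk ≠ 1 := fun e => hk1 (by simpa [hkk] using congrArg Fin.val e)
    rw [rowDigit, dif_pos hk, if_neg hkk1, if_neg hk1]
    unfold mulAct
    rw [hsymm 1, hsymm kk]
    have h1 : (⟨pinv (INV11.getD u 0) (1 : Fin 12), pinv_lt _ _⟩ : Fin 12) = 1 := by
      apply Fin.ext; show pinv (INV11.getD u 0) 1 = 1; rfl
    rw [h1, ZMod.val_mul, ZMod.val_natCast, Nat.mod_eq_of_lt (show u < 11 by omega)]
    have hne : (⟨pinv (INV11.getD u 0) kk, pinv_lt _ _⟩ : Fin 12) ≠ 1 := fun e =>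
      pinv_ne_one u hu1 hu2 kk hkk1 (by simpa using congrArg Fin.val e)
    have hd : dg (pack16 (rowDigit a 1) 12) (pinv (INV11.getD u 0) k) = (a 1 ⟨pinv (INV11.getD u 0) kk, pinv_lt _ _⟩).val :=
      dg_packRow a 1 ⟨pinv (INV11.getD u 0) kk, pinv_lt _ _⟩ hne
    rw [hd]

end Homology12

end Summit.Ventures.DiscreteObjects.PP12
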